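import Literature.NumberTheory.GaloisCohomology.Howard2004.SelmerTriples
import Literature.NumberTheory.GaloisCohomology.Howard2004.FiniteSingularEvaluation
import Literature.NumberTheory.GaloisRepresentations.ContinuousH1OpenKernelProofs
import Literature.NumberTheory.GaloisRepresentations.UnramifiedClassesInertia
import HarnessLib

/-!
# `H¹_f(K_λ, T) ∩ H¹_tr(K_λ, T) = 0` when `K[ℓ]_λ/K_λ` is totally ramified and `Γ_{K_λ}` acts trivially
# (the disjointness half of Howard 2004, Prop. 1.1.9; proofs file)

Topic `NumberTheory/GaloisCohomology/Howard2004` (vocabulary of `SelmerTriples.lean`: `transverseFixer`,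
`localRingClassSubgroup`, `transverseCondition`; of `GaloisRepresentations/LocalGaloisGroup`,
`UnramifiedClassesInertia`: `absInertia`, `unramifiedSubgroup`; of `ContinuousH1OpenKernelProofs`:
`resSubgroup_oneCocycleClass_eq_zero_iff`).  THEOREMS ONLY: no definition, no named fact, no instance,
no `sorry`.

B. Howard, *The Heegner point Kolyvagin system*, Compositio Math. 140 (2004), Prop. 1.1.9 (= arXiv:1202.6340
Prop. 2.1.9, p. 6 L17–25): for `ℓ ∤ p` with `T` unramified at the degree-two prime `λ ∣ ℓ`, `Frob_λ` trivial on
`T` and `|k_λ^×|·T = 0`, «`H¹(K_λ, T) = H¹_f(K_λ, T) ⊕ H¹_tr(K_λ, T)`», where (§1.2, p. 6 L84–95) `H¹_tr` is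
the `L`-transverse condition for `L` = the maximal `p`-subextension of `K[ℓ]_λ/K_λ`, «a maximal totally tamely
ramified abelian `p`-extension of `K_λ`» («since `λ` splits completely in the Hilbert class field of `K`»;
Gross 1991 §3: «the factors `λ_m` of `λ` in `K_m` are totally ramified in `K_n`»).

WHAT IS PROVED — the DISJOINTNESS `H¹_f ∩ H¹_tr = 0`, from the one classical input that makes it true, stated
as a hypothesis in the tree's currency: **`Γ_{K_λ} = I_{K_λ} · Γ'`** for a subgroup `Γ' ≤ Γ_L` (e.g.
`Γ' = Γ_{K_λ} ∩ Γ_{K[ℓ]} = localRingClassSubgroup ℓ jbar λ`: «`K[ℓ]_λ/K_λ` is totally ramified», i.e. the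
inertia group surjects onto `Gal(K[ℓ]_λ/K_λ)`), together with the triviality of the `Γ_{K_λ}`-action on `T`
(Howard's standing at `λ ∈ 𝓛_k(T)`: `T` unramified at `λ` and `Frob_λ ≡ 1`):
* §1 (any non-archimedean local field `F`, any discrete `W` with trivial `Γ_F`-action, any `Λ ≤ Γ_F` with
  `Γ_F = I_F · Λ`): `disjoint_unramifiedSubgroup_ker_resSubgroup` — `H¹_ur(F, W) ∩ ker(H¹(F, W) → H¹(Λ, W)) = 0`
  (an unramified class is a homomorphism vanishing on `I_F`, a `Λ`-transverse one vanishes on `Λ`, hence on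
  `I_F · Λ = Γ_F`); `eq_zero_of_mem_unramifiedSubgroup_of_resSubgroup_eq_zero` (element form).
* §1b (Frobenius form): `…_of_isFrobPow` — the same as soon as ONE arithmetic Frobenius lies in `I_F · Λ`
  (an unramified class vanishing at a Frobenius is zero: tree `evalClass_eq_zero_of_mem_unramified`).
* §2 (Howard's `λ`, `T`): **`disjoint_unramifiedSubgroup_transverseCondition`** (+ `…_of_isFrobPow`) —
  `Disjoint (H¹_ur(K_λ, T)) (transverseCondition p T ℓ jbar λ)` given
  `∀ σ, ∃ τ ∈ I_{K_λ}, τ⁻¹σ ∈ localRingClassSubgroup ℓ jbar λ` and the trivial action; the same with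
  `transverseFixer` in the hypothesis; and the `SelmerTriple` reading
  `disjoint_cond_transverseStructure` (`Disjoint (t.cond (Sum.inr λ)) (transverseStructure p T jbar (Sum.inr λ))`
  at `λ ∈ 𝓛`) = the hypothesis `hdisj` of `SelmerStructureModifyOnePlaceProofs` /
  `Howard2004/KolyvaginRelationLocalizationProofs`, `hdis` of the parity count, `hc.1` of the Lagrangian algebra.
NOT here: the discharge of the totally-ramified hypothesis from the class field theory of ring class fields
(tree `EllipticCurves/RingClassFieldInertiaGenerator`: `I_𝔓 ↠ Gal(K[ℓm]/K[m])`, and «`λ` splits completely in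
`K[1]`»), and the complementary half `H¹_f + H¹_tr = H¹` with the freeness of both (Prop. 1.1.7 / 1.1.9).

Cell `pub/bsd-print-x9`, G87 = Howard 2004 Thm. 1.6.1 (print leaf `stub_h161` of stmt-BirchSwinnertonDyer-22642);
seat `bsd-line-x9-p1-w3` g14, brick (SPLIT-DISJ).  BSD is not proved by any of this.

References: [Howard2004HeegnerKolyvagin] Prop. 1.1.9, §1.2 (arXiv:1202.6340 p. 6); [GrossLMS1991] B. H. Gross,
*Kolyvagin's work on modular elliptic curves*, LMS LNS 153 (1991), §3; [MazurRubinMemoirs2004] Def. 1.1.6 (iv),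
Prop. 1.3.2; [SerreGaloisCohomology1997] I §2.2, I §5.1.
-/

set_option autoImplicit false

noncomputable section

open Function NumberField IsDedekindDomain Field
open scoped NumberField ContRepresentation

universe u

namespace Literature.NumberTheory.GaloisRepresentations.DiscreteGaloisModule

open Literature.NumberTheory.GaloisRepresentations

/-! ## §1 Local: unramified and `Λ`-transverse classes are disjoint when `Γ_F = I_F · Λ` -/

section Local

variable {F : Type u} [Field F] [ValuativeRel F] [TopologicalSpace F] [IsNonarchimedeanLocalField F]
  {W : Type u} [AddCommGroup W] [TopologicalSpace W] [DiscreteTopology W]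

/-- **An unramified class which dies on `Λ` is zero, when `Γ_F = I_F · Λ` and `Γ_F` acts trivially**: with
trivial action a class is a continuous homomorphism `φ : Γ_F → W`; unramified means `φ(I_F) = 0`, dying on
`Λ` means `φ(Λ) = 0` (principal = zero), and every `σ = τ · (τ⁻¹σ)` with `τ ∈ I_F`, `τ⁻¹σ ∈ Λ`.
[cite: Howard2004HeegnerKolyvagin, Prop. 1.1.9 (arXiv:1202.6340 Prop. 2.1.9, p. 6 L17–25)]
[cite: MazurRubinMemoirs2004, Def. 1.1.6 (iv) and Prop. 1.3.2] -/
theorem eq_zero_of_mem_unramifiedSubgroup_of_resSubgroup_eq_zero (ρ : DiscreteGaloisModule F W)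
    (Λ : Subgroup (absoluteGaloisGroup F)) (htriv : ∀ (g : absoluteGaloisGroup F) (w : W), ρ g w = w)
    (htot : ∀ σ : absoluteGaloisGroup F, ∃ τ ∈ absInertia F, τ⁻¹ * σ ∈ Λ)
    {c : galoisCohomology ρ 1} (hur : c ∈ ρ.unramifiedSubgroup 1)
    (hΛ : resSubgroup ρ.toTopRep Λ 1 c = 0) : c = 0 := by
  obtain ⟨φ, rfl⟩ := oneCocycleClass_surjective ρ.toTopRep c
  have hI : ∀ τ ∈ absInertia F, φ.1 τ = 0 :=
    (ρ.oneCocycleClass_mem_unramifiedSubgroup_iff_forall_eq_zero (fun τ _ w => htriv τ w) φ).1 hur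
  have hΛ' : ∀ g ∈ Λ, φ.1 g = 0 := by
    obtain ⟨w, hw⟩ := (resSubgroup_oneCocycleClass_eq_zero_iff ρ.toTopRep Λ φ).1 hΛ
    intro g hg
    rw [hw g hg, ContinuousRep.toTopRep_ρ_apply, htriv g w, sub_self]
  refine (oneCocycleClass_eq_zero_iff ρ.toTopRep φ).2 ⟨0, fun σ => ?_⟩
  obtain ⟨τ, hτ, hn⟩ := htot σ
  have hστ : σ = τ * (τ⁻¹ * σ) := by group
  rw [map_zero, sub_zero, hστ, φ.2 τ (τ⁻¹ * σ), hI τ hτ, hΛ' _ hn, map_zero, add_zero]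

/-- **`H¹_ur(F, W) ∩ ker (H¹(F, W) → H¹(Λ, W)) = 0`** when `Γ_F = I_F · Λ` and `Γ_F` acts trivially on `W`
(the kernel written as the tree writes the transverse conditions: `(resSubgroup _ Λ 1).hom…ker`).
[cite: Howard2004HeegnerKolyvagin, Prop. 1.1.9 (arXiv:1202.6340 Prop. 2.1.9, p. 6 L17–25)]
[cite: MazurRubinMemoirs2004, Def. 1.1.6 (iv) and Prop. 1.3.2] -/
theorem disjoint_unramifiedSubgroup_ker_resSubgroup (ρ : DiscreteGaloisModule F W)
    (Λ : Subgroup (absoluteGaloisGroup F)) (htriv : ∀ (g : absoluteGaloisGroup F) (w : W), ρ g w = w)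
    (htot : ∀ σ : absoluteGaloisGroup F, ∃ τ ∈ absInertia F, τ⁻¹ * σ ∈ Λ) :
    Disjoint (ρ.unramifiedSubgroup 1)
      (resSubgroup ρ.toTopRep Λ 1).hom.toLinearMap.toAddMonoidHom.ker := by
  rw [disjoint_iff, eq_bot_iff]
  intro c hc
  obtain ⟨hur, hΛ⟩ := AddSubgroup.mem_inf.1 hc
  rw [AddSubgroup.mem_bot]
  exact eq_zero_of_mem_unramifiedSubgroup_of_resSubgroup_eq_zero ρ Λ htriv htot hur hΛ

end Local

end Literature.NumberTheory.GaloisRepresentations.DiscreteGaloisModule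

namespace Literature.NumberTheory.GaloisCohomology.Howard2004

open Literature.NumberTheory.GaloisRepresentations
open Literature.NumberTheory.GaloisRepresentations.DiscreteGaloisModule

/-! ## §1b Local, Frobenius form: it suffices that ONE Frobenius lie in `I_F · Λ` -/

section LocalFrob

variable {F : Type} [Field F] [ValuativeRel F] [TopologicalSpace F] [IsNonarchimedeanLocalField F]
  {N : Type} [AddCommGroup N] [TopologicalSpace N] [DiscreteTopology N]

/-- **An unramified class which dies on `Λ` is zero as soon as ONE arithmetic Frobenius `φ` lies in
`I_F · Λ`** (trivial action): the class is a homomorphism vanishing on `I_F` and on `Λ`, hence at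
`φ = τ · (τ⁻¹φ)`; and an unramified class vanishing at a Frobenius is zero (`I_F·⟨φ⟩` is dense in `Γ_F`,
tree `evalClass_eq_zero_of_mem_unramified`).
[cite: Howard2004HeegnerKolyvagin, Prop. 1.1.7 / Prop. 1.1.9 (arXiv:1202.6340 p. 5 L129–138, p. 6 L17–25)] -/
theorem eq_zero_of_mem_unramifiedSubgroup_of_resSubgroup_eq_zero_of_isFrobPow
    (ρ : DiscreteGaloisModule F N) (Λ : Subgroup (absoluteGaloisGroup F))
    (htriv : ∀ (g : absoluteGaloisGroup F) (x : N), ρ g x = x) {φ : absoluteGaloisGroup F}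
    (hφ : IsFrobPow φ 1) (hφΛ : ∃ τ ∈ absInertia F, τ⁻¹ * φ ∈ Λ)
    {c : galoisCohomology ρ 1} (hur : c ∈ ρ.unramifiedSubgroup 1)
    (hΛ : resSubgroup ρ.toTopRep Λ 1 c = 0) : c = 0 := by
  obtain ⟨z, rfl⟩ := oneCocycleClass_surjective ρ.toTopRep c
  have hI : ∀ τ ∈ absInertia F, z.1 τ = 0 := (mem_unramified_iff_forall_apply_eq_zero ρ htriv z).1 hur
  have hΛ' : ∀ g ∈ Λ, z.1 g = 0 := by
    obtain ⟨w, hw⟩ := (resSubgroup_oneCocycleClass_eq_zero_iff ρ.toTopRep Λ z).1 hΛ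
    intro g hg
    rw [hw g hg, ContinuousRep.toTopRep_ρ_apply, htriv g w, sub_self]
  refine evalClass_eq_zero_of_mem_unramified ρ htriv hφ hur ?_
  obtain ⟨τ, hτ, hn⟩ := hφΛ
  have hφτ : φ = τ * (τ⁻¹ * φ) := by group
  rw [evalClass_oneCocycleClass, hφτ, cocycle_apply_mul ρ htriv, hI τ hτ, hΛ' _ hn, add_zero]

/-- **`H¹_ur(F, N) ∩ ker (H¹(F, N) → H¹(Λ, N)) = 0` as soon as one arithmetic Frobenius lies in `I_F · Λ`**
(trivial `Γ_F`-action).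
[cite: Howard2004HeegnerKolyvagin, Prop. 1.1.7 / Prop. 1.1.9 (arXiv:1202.6340 p. 5 L129–138, p. 6 L17–25)] -/
theorem disjoint_unramifiedSubgroup_ker_resSubgroup_of_isFrobPow (ρ : DiscreteGaloisModule F N)
    (Λ : Subgroup (absoluteGaloisGroup F)) (htriv : ∀ (g : absoluteGaloisGroup F) (x : N), ρ g x = x)
    {φ : absoluteGaloisGroup F} (hφ : IsFrobPow φ 1) (hφΛ : ∃ τ ∈ absInertia F, τ⁻¹ * φ ∈ Λ) :
    Disjoint (ρ.unramifiedSubgroup 1)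
      (resSubgroup ρ.toTopRep Λ 1).hom.toLinearMap.toAddMonoidHom.ker := by
  rw [disjoint_iff, eq_bot_iff]
  intro c hc
  obtain ⟨hur, hΛ⟩ := AddSubgroup.mem_inf.1 hc
  rw [AddSubgroup.mem_bot]
  exact eq_zero_of_mem_unramifiedSubgroup_of_resSubgroup_eq_zero_of_isFrobPow ρ Λ htriv hφ hφΛ hur hΛ

end LocalFrob

/-! ## §2 Howard's `H¹_f(K_λ, T) ∩ H¹_tr(K_λ, T) = 0` -/

section Howard

variable {K : Type} [Field K] [NumberField K] {M : Type} [AddCommGroup M] [TopologicalSpace M]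
  [DiscreteTopology M] (p : ℕ) [Fact p.Prime]

/-- **`H¹_f(K_λ, T) ∩ H¹_tr(K_λ, T) = 0`** (transverse condition cut out by any subgroup through which the
totally-ramified hypothesis is stated — here Howard's `Γ_L = transverseFixer`): for `T` with trivial
`Γ_{K_λ}`-action and `Γ_{K_λ} = I_{K_λ} · Γ_L`.
[cite: Howard2004HeegnerKolyvagin, Prop. 1.1.9 and §1.2 (arXiv:1202.6340 p. 6 L17–25, L84–95)] -/
theorem disjoint_unramifiedSubgroup_transverseCondition_of_transverseFixer (ρ : DiscreteGaloisModule K M)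
    (ℓ : ℕ) (jbar : AlgebraicClosure K →+* ℂ) (v : HeightOneSpectrum (𝓞 K))
    (htriv : ∀ (g : absoluteGaloisGroup (v.adicCompletion K)) (x : M), GaloisRep.toLocal v ρ g x = x)
    (htot : ∀ σ : absoluteGaloisGroup (v.adicCompletion K),
      ∃ τ ∈ absInertia (v.adicCompletion K), τ⁻¹ * σ ∈ transverseFixer p ℓ jbar v) :
    Disjoint (DiscreteGaloisModule.unramifiedSubgroup (GaloisRep.toLocal v ρ) 1)
      (transverseCondition p ρ ℓ jbar v) :=
  disjoint_unramifiedSubgroup_ker_resSubgroup (GaloisRep.toLocal v ρ) (transverseFixer p ℓ jbar v) htriv htot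

/-- **`H¹_f(K_λ, T) ∩ H¹_tr(K_λ, T) = 0` from «`K[ℓ]_λ/K_λ` is totally ramified»**: it suffices that every
`σ ∈ Γ_{K_λ}` be an inertia element times an element fixing `K[ℓ]` (`localRingClassSubgroup ℓ jbar λ =
Γ_{K_λ} ∩ Γ_{K[ℓ]} ≤ Γ_L`), `Γ_{K_λ}` acting trivially on `T` — Howard's standing at a prime `λ ∈ 𝓛_k(T)`
(«`λ` splits completely in the Hilbert class field», `K[ℓ]/K[1]` totally ramified at `λ`: Gross 1991 §3).
[cite: Howard2004HeegnerKolyvagin, Prop. 1.1.9 and §1.2 (arXiv:1202.6340 p. 6 L17–25, L84–95)]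
[cite: GrossLMS1991, §3 (proof of Prop. 3.7 (2))] -/
theorem disjoint_unramifiedSubgroup_transverseCondition (ρ : DiscreteGaloisModule K M)
    (ℓ : ℕ) (jbar : AlgebraicClosure K →+* ℂ) (v : HeightOneSpectrum (𝓞 K))
    (htriv : ∀ (g : absoluteGaloisGroup (v.adicCompletion K)) (x : M), GaloisRep.toLocal v ρ g x = x)
    (htot : ∀ σ : absoluteGaloisGroup (v.adicCompletion K),
      ∃ τ ∈ absInertia (v.adicCompletion K), τ⁻¹ * σ ∈ localRingClassSubgroup ℓ jbar v) :
    Disjoint (DiscreteGaloisModule.unramifiedSubgroup (GaloisRep.toLocal v ρ) 1)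
      (transverseCondition p ρ ℓ jbar v) :=
  disjoint_unramifiedSubgroup_transverseCondition_of_transverseFixer p ρ ℓ jbar v htriv fun σ =>
    let ⟨τ, hτ, hn⟩ := htot σ
    ⟨τ, hτ, localRingClassSubgroup_le_transverseFixer p ℓ jbar v hn⟩

/-- **The `SelmerTriple` reading**: at a Kolyvagin prime `λ ∈ 𝓛` of a Selmer triple `t` (so `t.cond λ` is the
unramified condition, `cond_inr_eq_of_mem`), with `Γ_{K_λ}` acting trivially on `T` and `K[ℓ]_λ/K_λ` totally
ramified (`ℓ` the residue characteristic of `λ`), the finite and the transverse local conditions at `λ` are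
disjoint: `Disjoint (t.cond (Sum.inr λ)) (transverseStructure p T jbar (Sum.inr λ))` — the hypothesis `hdisj`
of `SelmerStructureModifyOnePlaceProofs.localization_eq_zero_of_mem_selmerGroup_modify_insert`.
[cite: Howard2004HeegnerKolyvagin, Prop. 1.1.9, §1.2, Def. 1.2.2 (arXiv:1202.6340 p. 6)] -/
theorem SelmerTriple.disjoint_cond_transverseStructure {ρ : DiscreteGaloisModule K M}
    (t : SelmerTriple p ρ) (jbar : AlgebraicClosure K →+* ℂ) {v : HeightOneSpectrum (𝓞 K)}
    (hv : v ∈ t.primes)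
    (htriv : ∀ (g : absoluteGaloisGroup (v.adicCompletion K)) (x : M), GaloisRep.toLocal v ρ g x = x)
    (htot : ∀ σ : absoluteGaloisGroup (v.adicCompletion K),
      ∃ τ ∈ absInertia (v.adicCompletion K), τ⁻¹ * σ ∈ localRingClassSubgroup (residueChar v) jbar v) :
    Disjoint (t.cond (Sum.inr v)) (transverseStructure p ρ jbar (Sum.inr v)) := by
  rw [t.cond_inr_eq_of_mem hv, transverseStructure_inr]
  exact disjoint_unramifiedSubgroup_transverseCondition p ρ (residueChar v) jbar v htriv htot

/-- **`H¹_f(K_λ, T) ∩ H¹_tr(K_λ, T) = 0`, Frobenius form**: it suffices that ONE arithmetic Frobenius of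
`Γ_{K_λ}` be an inertia element times an element fixing `K[ℓ]` («`Frob_λ` acts on `K[ℓ]_λ` through the inertia
group», i.e. the residue extension of `K[ℓ]_λ/K_λ` is trivial: `λ` splits in `K[1]` and `K[ℓ]/K[1]` is
totally ramified at `λ`), `Γ_{K_λ}` acting trivially on `T`.
[cite: Howard2004HeegnerKolyvagin, Prop. 1.1.9 and §1.2 (arXiv:1202.6340 p. 6 L17–25, L84–95)]
[cite: GrossLMS1991, §3 (proof of Prop. 3.7 (2))] -/
theorem disjoint_unramifiedSubgroup_transverseCondition_of_isFrobPow (ρ : DiscreteGaloisModule K M)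
    (ℓ : ℕ) (jbar : AlgebraicClosure K →+* ℂ) (v : HeightOneSpectrum (𝓞 K))
    (htriv : ∀ (g : absoluteGaloisGroup (v.adicCompletion K)) (x : M), GaloisRep.toLocal v ρ g x = x)
    {φ : absoluteGaloisGroup (v.adicCompletion K)} (hφ : IsFrobPow φ 1)
    (hφΛ : ∃ τ ∈ absInertia (v.adicCompletion K), τ⁻¹ * φ ∈ localRingClassSubgroup ℓ jbar v) :
    Disjoint (DiscreteGaloisModule.unramifiedSubgroup (GaloisRep.toLocal v ρ) 1)
      (transverseCondition p ρ ℓ jbar v) :=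
  disjoint_unramifiedSubgroup_ker_resSubgroup_of_isFrobPow (GaloisRep.toLocal v ρ)
    (transverseFixer p ℓ jbar v) htriv hφ
    (let ⟨τ, hτ, hn⟩ := hφΛ; ⟨τ, hτ, localRingClassSubgroup_le_transverseFixer p ℓ jbar v hn⟩)

/-- The `SelmerTriple` reading, Frobenius form: at `λ ∈ 𝓛`, with trivial local action and one Frobenius in
`I_{K_λ} · (Γ_{K_λ} ∩ Γ_{K[ℓ]})`, `Disjoint (t.cond (Sum.inr λ)) (transverseStructure p T jbar (Sum.inr λ))`.
[cite: Howard2004HeegnerKolyvagin, Prop. 1.1.9, §1.2, Def. 1.2.2 (arXiv:1202.6340 p. 6)] -/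
theorem SelmerTriple.disjoint_cond_transverseStructure_of_isFrobPow {ρ : DiscreteGaloisModule K M}
    (t : SelmerTriple p ρ) (jbar : AlgebraicClosure K →+* ℂ) {v : HeightOneSpectrum (𝓞 K)}
    (hv : v ∈ t.primes)
    (htriv : ∀ (g : absoluteGaloisGroup (v.adicCompletion K)) (x : M), GaloisRep.toLocal v ρ g x = x)
    {φ : absoluteGaloisGroup (v.adicCompletion K)} (hφ : IsFrobPow φ 1)
    (hφΛ : ∃ τ ∈ absInertia (v.adicCompletion K),
      τ⁻¹ * φ ∈ localRingClassSubgroup (residueChar v) jbar v) :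
    Disjoint (t.cond (Sum.inr v)) (transverseStructure p ρ jbar (Sum.inr v)) := by
  rw [t.cond_inr_eq_of_mem hv, transverseStructure_inr]
  exact disjoint_unramifiedSubgroup_transverseCondition_of_isFrobPow p ρ (residueChar v) jbar v htriv hφ hφΛ

end Howard

end Literature.NumberTheory.GaloisCohomology.Howard2004

end
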